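import Summits.QuantumFields.YangMills.Theorems.BalabanUVNodesN07CurvFormTraceSU2
import Literature.MathematicalPhysics.QuantumFieldTheory.Balaban1983to89.Node00.BgLettersOfRecord
import Literature.MathematicalPhysics.QuantumFieldTheory.Balaban1983to89.B12Lemma4Models
import HarnessLib

/-!
# NODE N07 — THE HESSIAN LETTER `Δ(U₀) = hessOpOfRecord` OF def-Y's SCHEME RESPECTS THE TRACE SECTORS AT `N = 2`: on the `L²` bond carrier of record it maps TRACELESS-valued
# fields to traceless-valued fields and SCALAR-valued fields to scalar-valued fields (`D*D` at every `N` by transport invariance; `Δ′` at `N = 2` by ✓`…N07CurvFormTraceSU2` through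
# lit's Riesz reading ✓`inner_curvOp` and single-bond test functions) ([B9] (3.4), (3.9)–(3.10) pp. 391–392; [15] (51) p. 286)

Cell `pub-ymgap`, width seat `pub-ymgap-dag-n07-w3` (g26), CLAIM-15.  `--kind proof --supports stmt-QuantumFields-27238 --as helper`; count-neutral.
[15] = [Balaban1985Variational]; [B9] = [Balaban1985BackgroundPropagators].

CONTENTS (`φ = phiRec N`, `τ = tauRec N = tr`, weights `c₀ = η^d` of record; «traceless-valued» `f` := `∀ b, tr (φ (f b)) = 0`; «scalar-valued» := `∀ b, ∃ r, φ (f b) = r·1`).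
* §1 (lit carriers, any module `V`, any submodule `M`) `covCurl_mem`, `covCoCurl_mem`, `covLapPrincipal_mem` — `M`-valued in ⟹ `M`-valued out when the transporters preserve `M`.
* §2 (record fibre, every `N`) `trace_phiRec_adTransportW`, `adTransportW_smul_one`; ★`principalOpK_traceless`, ★`principalOpK_scalar` (`D*D` at every background, every `N`).
* §3 (record carrier, every `N`) single-bond test functions: `inner_bondSingle_left`; ★`traceless_of_inner_scalar_eq_zero` (⊥ all scalar-valued ⟹ traceless-valued),
  ★`scalar_of_inner_traceless_eq_zero` (⊥ all traceless-valued ⟹ scalar-valued; Frobenius `tr(P*P) = 0 ⟹ P = 0` on `P = slProj(φ X(b))`).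
* §4 (`N = 2`, det-one backgrounds) ★★`curvOp_traceless`, ★★`curvOp_scalar`, ★★`hessOp_traceless`, ★★`hessOp_scalar`; at the units of record: ★★★`hessOpOfRecord_traceless`,
  ★★★`hessOpOfRecord_scalar` — def-Y's letter `Δ(U₀) = hessOpOfRecord F 2 k U₀` preserves both trace sectors.

HONEST LABELS.  Finite-dimensional linear algebra; no estimate; the letters `G₁`, `K⁻¹`, `H₁`, `H♭`, `𝔊`, `π`, `Q`, `R`, `C^{𝔰𝔩}`, `W` of the rows' trace half are NOT here (next: the structural
ones at every `N`, the inverses by finite dimension).  Count-neutral; N07 NOT discharged; P0 ⟨26900⟩ OPEN; R4 is the conditional finite-𝕋⁴ rung only.  Nothing here is a claim about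
the Yang–Mills mass gap (`Summit.QuantumFields`): finite torus, fixed `ε`; nothing continuum ∕ OS ∕ Clay.
-/

set_option autoImplicit false

noncomputable section

open scoped Matrix Matrix.Norms.L2Operator InnerProductSpace ComplexConjugate BigOperators ComplexOrder

namespace Summit.QuantumFields.YangMills.Theorems.N07HessOpTraceSU2

open Literature.MathematicalPhysics.QuantumFieldTheory.Balaban1983to89
open Literature.MathematicalPhysics.QuantumFieldTheory.Balaban1983to89.T4Continuum (T4Family)
open T4Continuum BlockAveraging
open Node00
open B9SectCLatticeCarrier (Bond Plaq DirPair shift unshift)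
open B4Sect5Torus (TSite)
open B9Eq311L2Pairing (WL2)
open B9Eq34CovCurlVector (covCurl covCurl_apply_coord covCoCurl covCoCurl_apply covLapPrincipal covLapPrincipal_apply)
open B9Eq310HessianOperator (toAlg adTransportW adTransportW_apply principalOpK equiv_principalOpK curvOp inner_curvOp hessOp hessOp_apply)
open B11Eq103H1Complex (BondL2K funEquiv funEquiv_apply)
open B12Lemma4Models (slProj slProj_apply trace_slProj)
open Summit.QuantumFields.YangMills.Theorems.N07CurvFormTraceSU2 (units_mul_smul_one_mul_inv curvForm_eq_zero_of_traceless_scalar curvForm_eq_zero_of_scalar_traceless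
  det_coe_unitsOfRecord)

/-! ## §1  Submodule-valued fields under the covariant curl, co-curl and `D*D` -/

section Submodule

variable {𝕜 : Type*} [Field 𝕜] {V : Type*} [AddCommGroup V] [Module 𝕜 V] {d : ℕ} {Pd : Fin d → ℕ} (M : Submodule 𝕜 V)

/-- **If every transporter preserves a submodule `M` of the fibre, the covariant curl (3.4) maps `M`-valued bond functions to `M`-valued plaquette functions.**
[cite: Balaban1985BackgroundPropagators, (3.4) p.391; Balaban1985Variational, (51) p.286] -/
theorem covCurl_mem (c : 𝕜) {R : Bond d Pd → V →ₗ[𝕜] V} (hR : ∀ b v, v ∈ M → R b v ∈ M) {A : Bond d Pd → V} (hA : ∀ b, A b ∈ M) (p : Plaq d Pd) :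
    covCurl c R A p ∈ M := by
  obtain ⟨x, q⟩ := p
  rw [covCurl_apply_coord]
  exact M.sub_mem (M.smul_mem _ (M.sub_mem (hR _ _ (hA _)) (hA _))) (M.smul_mem _ (M.sub_mem (hR _ _ (hA _)) (hA _)))

/-- **… and the covariant co-curl (3.9) maps `M`-valued plaquette functions to `M`-valued bond functions.** [cite: Balaban1985BackgroundPropagators, (3.9) p.392] -/
theorem covCoCurl_mem (c : 𝕜) {S : Bond d Pd → V →ₗ[𝕜] V} (hS : ∀ b v, v ∈ M → S b v ∈ M) {G : Plaq d Pd → V} (hG : ∀ p, G p ∈ M) (b : Bond d Pd) :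
    covCoCurl c S G b ∈ M := by
  obtain ⟨y, κ⟩ := b
  rw [covCoCurl_apply]
  exact M.smul_mem _ (M.sub_mem (M.sum_mem fun q _ => M.sub_mem (hS _ _ (hG _)) (hG _)) (M.sum_mem fun q _ => M.sub_mem (hS _ _ (hG _)) (hG _)))

/-- **… hence `D*D` maps `M`-valued to `M`-valued.** [cite: Balaban1985BackgroundPropagators, (3.10) p.392] -/
theorem covLapPrincipal_mem (c : 𝕜) {R S : Bond d Pd → V →ₗ[𝕜] V} (hR : ∀ b v, v ∈ M → R b v ∈ M) (hS : ∀ b v, v ∈ M → S b v ∈ M)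
    {A : Bond d Pd → V} (hA : ∀ b, A b ∈ M) (b : Bond d Pd) : covLapPrincipal c R S A b ∈ M := by
  rw [covLapPrincipal_apply]
  exact covCoCurl_mem M c hS (covCurl_mem M c hR hA) b

end Submodule

/-! ## §2  The record fibre: transport preserves traces and scalars; `D*D` respects both sectors at every `N` -/

section Fibre

variable (N : ℕ) {d : ℕ} {Pd : Fin d → ℕ} (V : Bond d Pd → (Matrix (Fin N) (Fin N) ℂ)ˣ)

/-- `tr φ(R(V(b))w) = tr φ(w)` — transport on the Hilbert fibre of record preserves the trace. [cite: Balaban1985BackgroundPropagators, (3.2) p.391] -/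
theorem trace_phiRec_adTransportW (b : Bond d Pd) (w : WRec N) : (phiRec N (adTransportW (phiRec N) V b w)).trace = (phiRec N w).trace := by
  rw [adTransportW_apply, LinearEquiv.apply_symm_apply, Matrix.trace_mul_cycle, Units.inv_mul, one_mul]

/-- Transport on the Hilbert fibre of record fixes scalars: `R(V(b))φ⁻¹(r·1) = φ⁻¹(r·1)`. [cite: Balaban1985BackgroundPropagators, p.390] -/
theorem adTransportW_smul_one (b : Bond d Pd) (r : ℂ) :
    adTransportW (phiRec N) V b ((phiRec N).symm (r • (1 : Matrix (Fin N) (Fin N) ℂ))) = (phiRec N).symm (r • (1 : Matrix (Fin N) (Fin N) ℂ)) := by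
  rw [adTransportW_apply, LinearEquiv.apply_symm_apply, units_mul_smul_one_mul_inv]

variable {c₀ : ℝ} (η : ℝ)

/-- ★ **`D*D` MAPS TRACELESS-VALUED FIELDS TO TRACELESS-VALUED FIELDS**, every `N`, every background (§1 with `M :=` the traceless fibre vectors).
[cite: Balaban1985BackgroundPropagators, (3.10) p.392; Balaban1985Variational, (51) p.286] -/
theorem principalOpK_traceless {f : BondL2K ℂ d Pd c₀ (WRec N)} (hf : ∀ b, (phiRec N (WL2.equiv ℂ _ (WRec N) f b)).trace = 0) (b : Bond d Pd) :
    (phiRec N (WL2.equiv ℂ _ (WRec N) (principalOpK (phiRec N) η V f) b)).trace = 0 := by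
  let M : Submodule ℂ (WRec N) := LinearMap.ker (Matrix.traceLinearMap (Fin N) ℂ ℂ ∘ₗ (phiRec N).toLinearMap)
  have hM : ∀ w : WRec N, w ∈ M ↔ (phiRec N w).trace = 0 := fun w => by
    simp only [M, LinearMap.mem_ker, LinearMap.coe_comp, Function.comp_apply, LinearEquiv.coe_coe, Matrix.traceLinearMap_apply]
  have hR : ∀ (U : Bond d Pd → (Matrix (Fin N) (Fin N) ℂ)ˣ) b (v : WRec N), v ∈ M → adTransportW (phiRec N) U b v ∈ M := fun U b v hv => by
    rw [hM] at hv ⊢; rw [trace_phiRec_adTransportW, hv]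
  rw [equiv_principalOpK, ← hM]
  exact covLapPrincipal_mem M _ (hR V) (hR fun b => (V b)⁻¹) (fun b => (hM _).2 (hf b)) b

/-- ★ **`D*D` MAPS SCALAR-VALUED FIELDS TO SCALAR-VALUED FIELDS**, every `N`, every background (§1 with `M := φ⁻¹(ℂ·1)`).
[cite: Balaban1985BackgroundPropagators, (3.10) p.392] -/
theorem principalOpK_scalar {f : BondL2K ℂ d Pd c₀ (WRec N)} (hf : ∀ b, ∃ r : ℂ, phiRec N (WL2.equiv ℂ _ (WRec N) f b) = r • (1 : Matrix (Fin N) (Fin N) ℂ))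
    (b : Bond d Pd) : ∃ r : ℂ, phiRec N (WL2.equiv ℂ _ (WRec N) (principalOpK (phiRec N) η V f) b) = r • (1 : Matrix (Fin N) (Fin N) ℂ) := by
  let M : Submodule ℂ (WRec N) := ℂ ∙ (phiRec N).symm (1 : Matrix (Fin N) (Fin N) ℂ)
  have hM : ∀ w : WRec N, w ∈ M ↔ ∃ r : ℂ, phiRec N w = r • (1 : Matrix (Fin N) (Fin N) ℂ) := fun w => by
    rw [Submodule.mem_span_singleton]
    constructor
    · rintro ⟨r, hr⟩; exact ⟨r, by rw [← hr, map_smul, LinearEquiv.apply_symm_apply]⟩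
    · rintro ⟨r, hr⟩; exact ⟨r, by rw [← map_smul, ← hr, LinearEquiv.symm_apply_apply]⟩
  have hR : ∀ (U : Bond d Pd → (Matrix (Fin N) (Fin N) ℂ)ˣ) b (v : WRec N), v ∈ M → adTransportW (phiRec N) U b v ∈ M := fun U b v hv => by
    obtain ⟨r, hr⟩ := (hM v).1 hv
    have hv' : v = (phiRec N).symm (r • (1 : Matrix (Fin N) (Fin N) ℂ)) := by rw [← hr, LinearEquiv.symm_apply_apply]
    rw [hv', adTransportW_smul_one]
    exact (hM _).2 ⟨r, LinearEquiv.apply_symm_apply _ _⟩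
  rw [equiv_principalOpK, ← hM]
  exact covLapPrincipal_mem M _ (hR V) (hR fun b => (V b)⁻¹) (fun b => (hM _).2 (hf b)) b

end Fibre

/-! ## §3  Single-bond test functions: orthogonality characterises the two sectors -/

section Record

variable (F : T4Family) (N : ℕ) (K : ℕ) (k : ℕ) [Fact (0 < c0Rec F K k)]

/-- The scalar product against a single-bond test function: `⟪δ_b w, X⟫ = c₀ ⟪w, X(b)⟫`. [cite: Balaban1985BackgroundPropagators, (3.11) p.392] -/
theorem inner_bondSingle_left (b : Bond (F.P K).d (fun _ => (F.P K).sitesPerDir 0)) (w : WRec N)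
    (X : BondL2K ℂ (F.P K).d (fun _ => (F.P K).sitesPerDir 0) (c0Rec F K k) (WRec N)) :
    ⟪((WL2.equiv ℂ _ (WRec N)).symm (Pi.single b w) : BondL2K ℂ (F.P K).d (fun _ => (F.P K).sitesPerDir 0) (c0Rec F K k) (WRec N)), X⟫_ℂ =
      (c0Rec F K k : ℂ) * ⟪w, WL2.equiv ℂ _ (WRec N) X b⟫_ℂ := by
  rw [WL2.inner_def, Finset.sum_eq_single b (fun b' _ hb' => by rw [Equiv.apply_symm_apply, Pi.single_eq_of_ne hb', inner_zero_left, mul_zero])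
    (fun h => (h (Finset.mem_univ b)).elim), Equiv.apply_symm_apply, Pi.single_eq_same]
  rfl

/-- ★ **A FIELD ORTHOGONAL TO EVERY SCALAR-VALUED FIELD IS TRACELESS-VALUED** (test with `δ_b φ⁻¹(1)`: `⟪δ_b φ⁻¹1, X⟫ = c₀ tr φ(X(b))`).
[cite: Balaban1985BackgroundPropagators, p.391 («X·Y = tr XY»); Balaban1985Variational, (51) p.286] -/
theorem traceless_of_inner_scalar_eq_zero {X : BondL2K ℂ (F.P K).d (fun _ => (F.P K).sitesPerDir 0) (c0Rec F K k) (WRec N)}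
    (h : ∀ f : BondL2K ℂ (F.P K).d (fun _ => (F.P K).sitesPerDir 0) (c0Rec F K k) (WRec N),
      (∀ b, ∃ r : ℂ, phiRec N (WL2.equiv ℂ _ (WRec N) f b) = r • (1 : Matrix (Fin N) (Fin N) ℂ)) → ⟪f, X⟫_ℂ = 0)
    (b : Bond (F.P K).d (fun _ => (F.P K).sitesPerDir 0)) : (phiRec N (WL2.equiv ℂ _ (WRec N) X b)).trace = 0 := by
  have hc : (c0Rec F K k : ℂ) ≠ 0 := by exact_mod_cast (Fact.out : 0 < c0Rec F K k).ne'
  have hf := h ((WL2.equiv ℂ _ (WRec N)).symm (Pi.single b ((phiRec N).symm 1))) fun b' => by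
    by_cases hb : b' = b
    · subst hb; exact ⟨1, by rw [Equiv.apply_symm_apply, Pi.single_eq_same, LinearEquiv.apply_symm_apply, one_smul]⟩
    · exact ⟨0, by rw [Equiv.apply_symm_apply, Pi.single_eq_of_ne hb, map_zero, zero_smul]⟩
  rw [inner_bondSingle_left, mul_eq_zero] at hf
  have h0 := hf.resolve_left hc
  have hY : WL2.equiv ℂ _ (WRec N) X b = (phiRec N).symm (phiRec N (WL2.equiv ℂ _ (WRec N) X b)) := ((phiRec N).symm_apply_apply _).symm
  rw [hY, inner_phiRec_symm, star_one, one_mul, Matrix.traceLinearMap_apply] at h0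
  exact h0

/-- ★ **A FIELD ORTHOGONAL TO EVERY TRACELESS-VALUED FIELD IS SCALAR-VALUED** (test with `δ_b φ⁻¹(P)`, `P = φX(b) − N⁻¹(tr φX(b))·1` traceless: `tr(P*P) = 0 ⟹ P = 0`).
[cite: Balaban1985BackgroundPropagators, p.391; Balaban1985Variational, (51) p.286] -/
theorem scalar_of_inner_traceless_eq_zero {X : BondL2K ℂ (F.P K).d (fun _ => (F.P K).sitesPerDir 0) (c0Rec F K k) (WRec N)}
    (h : ∀ f : BondL2K ℂ (F.P K).d (fun _ => (F.P K).sitesPerDir 0) (c0Rec F K k) (WRec N),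
      (∀ b, (phiRec N (WL2.equiv ℂ _ (WRec N) f b)).trace = 0) → ⟪f, X⟫_ℂ = 0)
    (b : Bond (F.P K).d (fun _ => (F.P K).sitesPerDir 0)) : ∃ r : ℂ, phiRec N (WL2.equiv ℂ _ (WRec N) X b) = r • (1 : Matrix (Fin N) (Fin N) ℂ) := by
  have hc : (c0Rec F K k : ℂ) ≠ 0 := by exact_mod_cast (Fact.out : 0 < c0Rec F K k).ne'
  set Y : Matrix (Fin N) (Fin N) ℂ := phiRec N (WL2.equiv ℂ _ (WRec N) X b) with hYdef
  set P : Matrix (Fin N) (Fin N) ℂ := slProj N Y with hP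
  have hf := h ((WL2.equiv ℂ _ (WRec N)).symm (Pi.single b ((phiRec N).symm P))) fun b' => by
    by_cases hb : b' = b
    · subst hb; rw [Equiv.apply_symm_apply, Pi.single_eq_same, LinearEquiv.apply_symm_apply, hP]; exact trace_slProj _
    · rw [Equiv.apply_symm_apply, Pi.single_eq_of_ne hb, map_zero, Matrix.trace_zero]
  rw [inner_bondSingle_left, mul_eq_zero] at hf
  have h0 := hf.resolve_left hc
  have hY : WL2.equiv ℂ _ (WRec N) X b = (phiRec N).symm Y := by rw [hYdef, LinearEquiv.symm_apply_apply]
  rw [hY, inner_phiRec_symm, Matrix.traceLinearMap_apply] at h0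
  -- `Y = P + r·1` with `tr P = 0`, so `tr(P* Y) = tr(P* P)`, whence `P = 0`
  have hYP : Y = P + ((N : ℂ)⁻¹ * Y.trace) • (1 : Matrix (Fin N) (Fin N) ℂ) := by rw [hP, slProj_apply, sub_add_cancel]
  have hPP : (Pᴴ * P).trace = 0 := by
    have hPtr : (star P).trace = 0 := by rw [Matrix.star_eq_conjTranspose, Matrix.trace_conjTranspose, hP, trace_slProj, star_zero]
    rw [hYP, mul_add, Matrix.trace_add, mul_smul_comm, mul_one, Matrix.trace_smul, hPtr, smul_zero, add_zero, Matrix.star_eq_conjTranspose] at h0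
    exact h0
  have hP0 : P = 0 := Matrix.trace_conjTranspose_mul_self_eq_zero_iff.1 hPP
  rw [hP0, zero_add] at hYP
  exact ⟨_, hYP⟩

end Record

/-! ## §4  At `N = 2`: `Δ′` and `Δ = D*D + Δ′` respect both sectors; the letter `hessOpOfRecord F 2 k U₀` -/

section SU2

variable (F : T4Family) (K : ℕ) (k : ℕ) [Fact (0 < c0Rec F K k)] (η : ℝ) (V : Bond (F.P K).d (fun _ => (F.P K).sitesPerDir 0) → (Matrix (Fin 2) (Fin 2) ℂ)ˣ)

/-- ★★ **`Δ′` MAPS TRACELESS-VALUED TO TRACELESS-VALUED at a background of `2 × 2` units of determinant one** (Riesz reading ✓`inner_curvOp` + ✓`curvForm_eq_zero_of_scalar_traceless` + §3).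
[cite: Balaban1985BackgroundPropagators, (3.10) p.392; Balaban1985Variational, (51) p.286] -/
theorem curvOp_traceless (hV : ∀ b, ((V b : (Matrix (Fin 2) (Fin 2) ℂ)ˣ) : Matrix (Fin 2) (Fin 2) ℂ).det = 1)
    {g : BondL2K ℂ (F.P K).d (fun _ => (F.P K).sitesPerDir 0) (c0Rec F K k) (WRec 2)} (hg : ∀ b, (phiRec 2 (WL2.equiv ℂ _ (WRec 2) g b)).trace = 0)
    (b : Bond (F.P K).d (fun _ => (F.P K).sitesPerDir 0)) : (phiRec 2 (WL2.equiv ℂ _ (WRec 2) (curvOp (phiRec 2) (tauRec 2) η V g) b)).trace = 0 := by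
  refine traceless_of_inner_scalar_eq_zero F 2 K k (fun f hf => ?_) b
  choose r hr using hf
  rw [inner_curvOp]
  refine curvForm_eq_zero_of_scalar_traceless (tauRec 2) V (fun a c => by rw [Matrix.traceLinearMap_apply, Matrix.traceLinearMap_apply, Matrix.trace_mul_comm])
    hV η (c := fun b => star (r b)) (fun b' => ?_) (fun b' => ?_)
  · simp only [Pi.star_apply, toAlg, funEquiv_apply]; rw [hr b', star_smul, star_one]
  · simp only [toAlg, funEquiv_apply, Matrix.traceLinearMap_apply]; exact hg b'

/-- ★★ **`Δ′` MAPS SCALAR-VALUED TO SCALAR-VALUED at a background of `2 × 2` units of determinant one.** [cite: Balaban1985BackgroundPropagators, (3.10) p.392] -/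
theorem curvOp_scalar (hV : ∀ b, ((V b : (Matrix (Fin 2) (Fin 2) ℂ)ˣ) : Matrix (Fin 2) (Fin 2) ℂ).det = 1)
    {g : BondL2K ℂ (F.P K).d (fun _ => (F.P K).sitesPerDir 0) (c0Rec F K k) (WRec 2)}
    (hg : ∀ b, ∃ r : ℂ, phiRec 2 (WL2.equiv ℂ _ (WRec 2) g b) = r • (1 : Matrix (Fin 2) (Fin 2) ℂ)) (b : Bond (F.P K).d (fun _ => (F.P K).sitesPerDir 0)) :
    ∃ r : ℂ, phiRec 2 (WL2.equiv ℂ _ (WRec 2) (curvOp (phiRec 2) (tauRec 2) η V g) b) = r • (1 : Matrix (Fin 2) (Fin 2) ℂ) := by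
  refine scalar_of_inner_traceless_eq_zero F 2 K k (fun f hf => ?_) b
  choose r hr using hg
  rw [inner_curvOp]
  refine curvForm_eq_zero_of_traceless_scalar (tauRec 2) V (fun a c => by rw [Matrix.traceLinearMap_apply, Matrix.traceLinearMap_apply, Matrix.trace_mul_comm])
    hV η (fun b' => ?_) (c := r) (fun b' => ?_)
  · simp only [Pi.star_apply, toAlg, funEquiv_apply, Matrix.traceLinearMap_apply]
    rw [Matrix.star_eq_conjTranspose, Matrix.trace_conjTranspose, hf b', star_zero]
  · simp only [toAlg, funEquiv_apply]; exact hr b'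

/-- ★★ **`Δ = D*D + Δ′` MAPS TRACELESS-VALUED TO TRACELESS-VALUED** (`2 × 2`, det-one background). [cite: Balaban1985BackgroundPropagators, (3.10) p.392; Balaban1985Variational, (51) p.286] -/
theorem hessOp_traceless (hV : ∀ b, ((V b : (Matrix (Fin 2) (Fin 2) ℂ)ˣ) : Matrix (Fin 2) (Fin 2) ℂ).det = 1)
    {g : BondL2K ℂ (F.P K).d (fun _ => (F.P K).sitesPerDir 0) (c0Rec F K k) (WRec 2)} (hg : ∀ b, (phiRec 2 (WL2.equiv ℂ _ (WRec 2) g b)).trace = 0)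
    (b : Bond (F.P K).d (fun _ => (F.P K).sitesPerDir 0)) : (phiRec 2 (WL2.equiv ℂ _ (WRec 2) (hessOp (phiRec 2) η V (tauRec 2) g) b)).trace = 0 := by
  rw [hessOp_apply, WL2.equiv_add, Pi.add_apply, map_add, Matrix.trace_add, principalOpK_traceless 2 V η hg b, curvOp_traceless F K k η V hV hg b, add_zero]

/-- ★★ **`Δ = D*D + Δ′` MAPS SCALAR-VALUED TO SCALAR-VALUED** (`2 × 2`, det-one background). [cite: Balaban1985BackgroundPropagators, (3.10) p.392] -/
theorem hessOp_scalar (hV : ∀ b, ((V b : (Matrix (Fin 2) (Fin 2) ℂ)ˣ) : Matrix (Fin 2) (Fin 2) ℂ).det = 1)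
    {g : BondL2K ℂ (F.P K).d (fun _ => (F.P K).sitesPerDir 0) (c0Rec F K k) (WRec 2)}
    (hg : ∀ b, ∃ r : ℂ, phiRec 2 (WL2.equiv ℂ _ (WRec 2) g b) = r • (1 : Matrix (Fin 2) (Fin 2) ℂ)) (b : Bond (F.P K).d (fun _ => (F.P K).sitesPerDir 0)) :
    ∃ r : ℂ, phiRec 2 (WL2.equiv ℂ _ (WRec 2) (hessOp (phiRec 2) η V (tauRec 2) g) b) = r • (1 : Matrix (Fin 2) (Fin 2) ℂ) := by
  obtain ⟨r₁, h₁⟩ := principalOpK_scalar 2 V η hg b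
  obtain ⟨r₂, h₂⟩ := curvOp_scalar F K k η V hV hg b
  exact ⟨r₁ + r₂, by rw [hessOp_apply, WL2.equiv_add, Pi.add_apply, map_add, h₁, h₂, add_smul]⟩

variable (U₀ : GaugeField (F.P K) 0 (SU 2))

/-- ★★★ **def-Y's LETTER `Δ(U₀) = hessOpOfRecord F 2 k U₀` MAPS TRACELESS-VALUED FIELDS TO TRACELESS-VALUED FIELDS** (the record's `SU(2)` background has det-one units).
[cite: Balaban1985BackgroundPropagators, (3.10) p.392; Balaban1985Variational, (51) p.286] -/
theorem hessOpOfRecord_traceless {g : BondL2K ℂ (F.P K).d (fun _ => (F.P K).sitesPerDir 0) (c0Rec F K k) (WRec 2)}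
    (hg : ∀ b, (phiRec 2 (WL2.equiv ℂ _ (WRec 2) g b)).trace = 0) (b : Bond (F.P K).d (fun _ => (F.P K).sitesPerDir 0)) :
    (phiRec 2 (WL2.equiv ℂ _ (WRec 2) (hessOpOfRecord F 2 k U₀ g) b)).trace = 0 :=
  hessOp_traceless F K k ((F.P K).eta k) (unitsOfRecord F 2 U₀) (det_coe_unitsOfRecord F 2 K U₀) hg b

/-- ★★★ **def-Y's LETTER `Δ(U₀) = hessOpOfRecord F 2 k U₀` MAPS SCALAR-VALUED FIELDS TO SCALAR-VALUED FIELDS.** [cite: Balaban1985BackgroundPropagators, (3.10) p.392] -/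
theorem hessOpOfRecord_scalar {g : BondL2K ℂ (F.P K).d (fun _ => (F.P K).sitesPerDir 0) (c0Rec F K k) (WRec 2)}
    (hg : ∀ b, ∃ r : ℂ, phiRec 2 (WL2.equiv ℂ _ (WRec 2) g b) = r • (1 : Matrix (Fin 2) (Fin 2) ℂ)) (b : Bond (F.P K).d (fun _ => (F.P K).sitesPerDir 0)) :
    ∃ r : ℂ, phiRec 2 (WL2.equiv ℂ _ (WRec 2) (hessOpOfRecord F 2 k U₀ g) b) = r • (1 : Matrix (Fin 2) (Fin 2) ℂ) :=
  hessOp_scalar F K k ((F.P K).eta k) (unitsOfRecord F 2 U₀) (det_coe_unitsOfRecord F 2 K U₀) hg b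

end SU2

end Summit.QuantumFields.YangMills.Theorems.N07HessOpTraceSU2

end
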